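import Literature.IUT.HodgeArakelov.BadPrimeGaussianMonoidsCor36Proofs2
import Literature.IUT.HodgeArakelov.GroupTheoreticThetaMonoids
import Literature.IUT.HodgeArakelov.TemperedThetaMonoidsProofs3
import Literature.IUT.HodgeArakelov.BadPrimeGaussianMonoidsRestrictionIsoKummerProofs
import HarnessLib

/-!
# [IUTchII] Cor 3.6 (ii) «↷» at abc-iut-L6-t2's abstraction with the TARGET CARRIER `Ψ_cns(M^Θ_*)` ITSELF: the
# equivariance `hequiv` of the Kummer copies DERIVED from the Prop 3.1 (ii) / 3.3 (ii) Kummer datum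
# (proof-only companion no. 7 of `BadPrimeGaussianMonoids.lean`; sequel to `BadPrimeGaussianMonoidsCor36Proofs2.lean`)

S. Mochizuki, *Inter-universal Teichmüller theory II*, §3, kurims Dec-2020 manuscript, Cor 3.6 (i)(ii) pp.99–100,
Prop 3.3 (ii) p.90, Prop 3.1 (ii) p.88 (IUTchII §3 Cor 3.6, kurims pp.99–101) [claim: Mochizuki2012, status: disputed]
(D-0012 claim key; nothing disputed is asserted — elementary monoid algebra over abc-iut-L6-t2's REAL objects).
abc-iut cell, sub-DAG `plan/L6/SUBDAG-IUTchII-Cor-36.md` rows Cor-36.i.r3 / ii.r9 (holder abc-iut-w5-d192). NO definition,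
NO `Prop` fact; print references are PARAPHRASES with locators on the writer's render (paper:url-5036b4059555).

WHY THIS FILE. In `BadPrimeGaussianMonoidsCor36Proofs.lean` (p414485) and `…Cor36Proofs2.lean` (p418727) the Galois
compatibility «↷» of the Kummer copies `(Ψ_{†C_v})_t ⥲ Ψ_cns(M^Θ_*)_t` (Cor 3.6 (i) p.99 l.40–47; = Prop 3.3 (ii) p.90
l.66–76 «compatible with the respective conjugation actions by Π_X(M^Θ_*)») is the inline hypothesis `hequiv`, at
an abstract target carrier `M`. When the target carrier is typed FAITHFULLY as the constant monoid `Ψ_cns(M^Θ_*)`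
itself — the subtype `↥E.constantMonoid` with the restricted conjugation action `ThetaEnvData.conjRestrict` of
`GroupTheoreticThetaMonoids.lean` — `hequiv` is a THEOREM of the Prop 3.1 (ii) / 3.3 (ii) Kummer datum
(`κ_O : O → H` equivariant with image `Ψ_cns`; GAP-LEDGER G-w4d019-1 datum, abc-iut-w4-d019's `(M_TM, actMTM, κ)`):
abc-iut-w4-d007 `TemperedThetaMonoids.constantMonoid_mulEquiv_equivariant` (TemperedThetaMonoidsProofs3, p412769) +
`constants_stable_of_equivariant_mrange` (TemperedThetaMonoidsProofs3). The theorems below record this and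
restate Cor-36.ii.r9 (Ψ-level exact, `∞`-level up to torsion) at that faithful target with the group
`G_v(M^Θ_*)_{⟨F_l^⋇⟩}` acting through any homomorphism `σ : G → Π_X(M^Θ_*)` (a section; «independent of t», Cor 3.5 (i)).
Companion of the cohomology-MODEL statements of `…Cor36Proofs2.lean` v3/v4 (labeled Kummer maps), where the same
derivation is `labelKummer_equivariant`. No file types restriction maps `r_t` with values in `↥Ψ_cns` yet (abc-iut-L6-t2 /
abc-iut-w4-d004 use an abstract `M` / the cohomology group), so the `hS` inputs below are the Cor 3.5 (ii) Galois
clause AT THAT TARGET, to be supplied by the schema theorems (`map_pi_diagonalStable_of_kummer_of_fixed`, …) there.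
HONEST FRAMING: elementary algebra; nothing here bears on [IUTchIII] Cor. 3.12; no side taken; typed ≠ endorsed.
v2: (a) line locators of the Cor 3.5 (ii) bracket (p.95 l.3–7) / Rmk 3.6.1 (p.101 l.6–9) corrected on the writer's render;
(b) APPEND § ThirdDisplayAtKummer — row Cor-36.ii.r10 end-to-end at the Kummer datum (abc-iut-w4-d004 p421047 BY NAME).
-/

namespace Literature.IUT.HodgeArakelov

namespace BadPrimeGaussianMonoids

open TemperedThetaMonoids

universe u v w

section KummerDatum

variable {P : Type u} [Group P] (E : TemperedThetaMonoids.ThetaEnvData.{u, v} P)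
  {O : Type w} [CommMonoid O] (ρ : P →* MulAut O) (κO : O →* E.H)

/-- **[Cor-36.i.r3 «↷» = Prop 3.3 (ii) equivariance, DERIVED]** (Cor 3.6 (i) p.99 l.40–47; Prop 3.3 (ii) p.90
l.66–76, paraphrase): an isomorphism `e : O ⥲ Ψ_cns` that is the Kummer map `κ_O` on elements intertwines the
`Π_X`-action `ρ` on `O = Ψ_{†C_v}` with the RESTRICTED conjugation action on `Ψ_cns` — i.e. the hypothesis `hequiv` of
`…Cor36Proofs(2)` holds — as soon as `κ_O` is equivariant with image `Ψ_cns`.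
(IUTchII §3 Cor 3.6 (i), kurims p.99) [claim: Mochizuki2012, status: disputed] -/
theorem kummerIso_hequiv_conjRestrict (hrange : MonoidHom.mrange κO = E.constants)
    (hκOeq : ∀ (g : P) (x : O), κO (ρ g x) = E.conj g (κO x))
    (e : O ≃* E.constantMonoid) (he : ∀ x : O, ((e x : E.constantMonoid) : E.H) = κO x) (g : P) (x : O) :
    e (ρ g x) =
      E.conjRestrict E.constantMonoid (constants_stable_of_equivariant_mrange E ρ κO hrange hκOeq) g (e x) :=
  Subtype.ext (by
    rw [ThetaEnvData.coe_conjRestrict_apply]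
    exact constantMonoid_mulEquiv_equivariant E ρ κO hκOeq e he g x)

/-- The same along a homomorphism `σ : G → Π_X(M^Θ_*)` through which `G_v(M^Θ_*)_{⟨F_l^⋇⟩}` acts (a section of
`Π_X ↠ G_v`; Cor 3.5 (i) «independent of t»). (IUTchII §3 Cor 3.6 (i), kurims p.99) [claim: Mochizuki2012, status: disputed] -/
theorem kummerIso_hequiv_conjRestrict_comp {G : Type*} [Group G] (σ : G →* P)
    (hrange : MonoidHom.mrange κO = E.constants) (hκOeq : ∀ (g : P) (x : O), κO (ρ g x) = E.conj g (κO x))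
    (e : O ≃* E.constantMonoid) (he : ∀ x : O, ((e x : E.constantMonoid) : E.H) = κO x) (g : G) (x : O) :
    e ((ρ.comp σ) g x) =
      ((E.conjRestrict E.constantMonoid (constants_stable_of_equivariant_mrange E ρ κO hrange hκOeq)).comp σ) g
        (e x) :=
  kummerIso_hequiv_conjRestrict E ρ κO hrange hκOeq e he (σ g) x

variable {T : Type*} {G : Type*} [Group G] (σ : G →* P)

/-- **[Cor-36.ii.r9, `Ψ`-level, target carrier `Ψ_cns` itself]** (Cor 3.6 (ii) p.100 l.23–26, paraphrase): the
Frobenioid-theoretic Gaussian monoid `Ψ_{F,ξ} = (piIso e)⁻¹(Ψ_ξ)`, `Ψ_ξ ⊆ ∏_{|t|} Ψ_cns`, is stable under the diagonal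
action of `G` through `ρ ∘ σ`, GIVEN only the Kummer datum (equivariant `κ_O` with image `Ψ_cns`, `e` = `κ_O` on
elements) and the Cor 3.5 (ii) Galois clause `hS` for `Ψ_ξ` at that target.
(IUTchII §3 Cor 3.6 (ii), kurims p.100) [claim: Mochizuki2012, status: disputed] -/
theorem frobenioidGaussianMonoid_diagonalStable_of_kummer (hrange : MonoidHom.mrange κO = E.constants)
    (hκOeq : ∀ (g : P) (x : O), κO (ρ g x) = E.conj g (κO x))
    (e : O ≃* E.constantMonoid) (he : ∀ x : O, ((e x : E.constantMonoid) : E.H) = κO x)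
    (ξ : T → E.constantMonoid)
    (hS : ∀ (g : G) (y : T → E.constantMonoid), y ∈ gaussianMonoid ξ →
      piIso T (E.conjRestrict E.constantMonoid (constants_stable_of_equivariant_mrange E ρ κO hrange hκOeq) (σ g))
        y ∈ gaussianMonoid ξ)
    (g : G) :
    (frobenioidGaussianMonoid e ξ).map (piIso T ((ρ.comp σ) g)).toMonoidHom = frobenioidGaussianMonoid e ξ :=
  frobenioidGaussianMonoid_diagonalStable_of_equivariant (ρ.comp σ)
    ((E.conjRestrict E.constantMonoid (constants_stable_of_equivariant_mrange E ρ κO hrange hκOeq)).comp σ) e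
    (kummerIso_hequiv_conjRestrict_comp E ρ κO σ hrange hκOeq e he) ξ hS g

/-- **[Cor-36.ii.r9, `∞`-level FAITHFUL FORM, target carrier `Ψ_cns` itself]** (Cor 3.6 (ii) p.100 with Cor 3.5 (ii)
p.95 l.3–7 / Rmk 3.6.1 p.101, paraphrase): `∞Ψ_{F,ξ} = (piIso e)⁻¹(∞Ψ_ξ)` is stable under the diagonal action of `G`
through `ρ ∘ σ` UP TO a torsion family, GIVEN only the Kummer datum and the up-to-torsion Galois clause `hS` for
`∞Ψ_ξ` at that target. (IUTchII §3 Cor 3.6 (ii), kurims p.100) [claim: Mochizuki2012, status: disputed] -/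
theorem inftyFrobenioidGaussianMonoid_diagonalStable_upToTorsion_of_kummer
    (hrange : MonoidHom.mrange κO = E.constants) (hκOeq : ∀ (g : P) (x : O), κO (ρ g x) = E.conj g (κO x))
    (e : O ≃* E.constantMonoid) (he : ∀ x : O, ((e x : E.constantMonoid) : E.H) = κO x)
    (ξ : T → E.constantMonoid)
    (hS : ∀ (g : G) (y : T → E.constantMonoid), y ∈ inftyGaussianMonoid ξ →
      ∃ u : T → E.constantMonoid, (∀ t, IsOfFinOrder (u t)) ∧
        u * piIso T (E.conjRestrict E.constantMonoid
          (constants_stable_of_equivariant_mrange E ρ κO hrange hκOeq) (σ g)) y ∈ inftyGaussianMonoid ξ)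
    (g : G) {x : T → O} (hx : x ∈ inftyFrobenioidGaussianMonoid e ξ) :
    ∃ v : T → O, (∀ t, IsOfFinOrder (v t)) ∧ v * piIso T ((ρ.comp σ) g) x ∈ inftyFrobenioidGaussianMonoid e ξ :=
  inftyFrobenioidGaussianMonoid_diagonalStable_upToTorsion_of_equivariant (ρ.comp σ)
    ((E.conjRestrict E.constantMonoid (constants_stable_of_equivariant_mrange E ρ κO hrange hκOeq)).comp σ) e
    (kummerIso_hequiv_conjRestrict_comp E ρ κO σ hrange hκOeq e he) ξ hS g hx

/-- The Kummer datum PROVIDES the isomorphism `e` (abc-iut-w4-d007 `exists_constantMonoid_mulEquiv`, p412769, Prop 3.1 (ii)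
«naturally isomorphic to `O^▷`»): packaged existence form of the `Ψ`-level statement — for an INJECTIVE equivariant
`κ_O` with image `Ψ_cns` there is a Kummer copy `e` (unique with `e = κ_O` on elements, `constantMonoid_mulEquiv_unique`)
for which every `Ψ_{F,ξ}` is diagonally stable given the Cor 3.5 (ii) clause at the target.
(IUTchII §3 Cor 3.6 (ii), kurims p.100) [claim: Mochizuki2012, status: disputed] -/
theorem exists_kummerIso_frobenioidGaussianMonoid_diagonalStable (hinj : Function.Injective κO)
    (hrange : MonoidHom.mrange κO = E.constants) (hκOeq : ∀ (g : P) (x : O), κO (ρ g x) = E.conj g (κO x)) :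
    ∃ e : O ≃* E.constantMonoid, (∀ x : O, ((e x : E.constantMonoid) : E.H) = κO x) ∧
      ∀ (ξ : T → E.constantMonoid),
        (∀ (g : G) (y : T → E.constantMonoid), y ∈ gaussianMonoid ξ →
          piIso T (E.conjRestrict E.constantMonoid
            (constants_stable_of_equivariant_mrange E ρ κO hrange hκOeq) (σ g)) y ∈ gaussianMonoid ξ) →
        ∀ g : G, (frobenioidGaussianMonoid e ξ).map (piIso T ((ρ.comp σ) g)).toMonoidHom =
          frobenioidGaussianMonoid e ξ := by
  obtain ⟨e, he⟩ := exists_constantMonoid_mulEquiv E κO hinj hrange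
  exact ⟨e, he, fun ξ hS g => frobenioidGaussianMonoid_diagonalStable_of_kummer E ρ κO σ hrange hκOeq e he ξ hS g⟩

end KummerDatum

/-! ### [Cor-36.ii.r10] the third display's `Ψ`-row END-TO-END at the Kummer datum (v2 append): the restriction
isomorphism's junction hypotheses `hU`/`hUsurj`/`hinj` DISCHARGED by abc-iut-w4-d004's
`exists_unique_restrictionIso'_ofKummer` (`BadPrimeGaussianMonoidsRestrictionIsoKummerProofs.lean`, p421047) -/

section ThirdDisplayAtKummer

variable {S : ThetaSetting.{u}} (A : AbsTopMonoids S) (Pc : IsoClass S.PiX)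
  {E : TemperedThetaMonoids.ThetaEnvData.{u, v} Pc.G} {F : TemperedFrobenioidThetaData.{u, v} Pc.G}
  (K : Prop33KummerStatements E F) (κ : A.MTM Pc →* E.H)
  {T : Type*} {M : Type*} [CommMonoid M] (κ₀ : A.MTM Pc →* M) {N : Type*} [CommMonoid N]

/-- **[Cor-36.ii.r10] `Ψ_{†F^Θ_v,α} ⥲ Ψ^ι_env(M^Θ_*) ⥲ Ψ_ξ(M^Θ_*) ⥲ Ψ_{F_ξ}(†F_v)` END-TO-END** (Cor 3.6 (ii) third display,
p.100 l.26–60, paraphrase: «by composing the Kummer isomorphisms … of Proposition 3.3, (i), (ii), with the restriction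
isomorphisms of Corollary 3.5, (ii), one obtains a diagram of compatible morphisms … isomorphisms of monoids»):
abc-iut-w4-d004's composite `exists_kummerRestrictionTransportIso'` (Proofs4) with its restriction isomorphism now
SUPPLIED by `exists_unique_restrictionIso'_ofKummer` — i.e. the Cor 3.5 (ii) junction hypotheses `hU`, `hUsurj`, `hinj`
are no longer binders: they are derived there from the Kummer data (K) (`κ`, `κ₀` injective, `Ψ_cns = κ(M_TM)`), the
restriction of constants (R) (`R_t ∘ κ = κ₀`), the theta evaluation (E) (`R_t θ = κ₀ q_t`, unique factorisation at one
label) and `horb`. Target carrier = the labeled copies `κ₀(M_TM)` of the constant monoid (a subtype), Kummer copy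
`e : N ⥲ κ₀(M_TM)` arbitrary. (IUTchII §3 Cor 3.6 (ii), kurims p.100) [claim: Mochizuki2012, status: disputed] -/
theorem exists_kummerRestrictionTransportIso'_ofKummer (α : Pc.G) (hκ : Function.Injective κ)
    (hcns : E.constantMonoid = MonoidHom.mrange κ) {θ : E.H} (hθ : θ ∈ E.thetaEnv (K.label α))
    (horb : ∀ θ' ∈ E.thetaEnv (K.label α), ∃ u ∈ E.units, θ' = u * θ)
    (R : T → (E.thetaMonoid (K.label α) →* M)) (q : T → A.MTM Pc)
    (hRκ : ∀ (t : T) (m : A.MTM Pc) (hm : κ m ∈ E.thetaMonoid (K.label α)), R t ⟨κ m, hm⟩ = κ₀ m)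
    (hRθ : ∀ t, R t ⟨θ, thetaEnv_subset_thetaMonoid E (K.label α) hθ⟩ = κ₀ (q t))
    (hκ₀ : Function.Injective κ₀) (t₀ : T)
    (hq₀ : ∀ (m m' : (A.MTM Pc)ˣ) (n n' : ℕ), (m : A.MTM Pc) * q t₀ ^ n = m' * q t₀ ^ n' → n = n' ∧ m = m')
    (e : N ≃* MonoidHom.mrange κ₀) :
    ∃ Φ : F.frobThetaMonoid α ≃*
        frobenioidGaussianMonoid e (fun t => (R t).codRestrict (MonoidHom.mrange κ₀)
          (restriction_mem_mrange A Pc E κ κ₀ R q hκ hcns hθ horb hRκ hRθ t)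
            ⟨θ, thetaEnv_subset_thetaMonoid E (K.label α) hθ⟩),
      ∀ x, piIso T e ((Φ x : frobenioidGaussianMonoid e _) : T → N) =
        MonoidHom.pi (fun t => (R t).codRestrict (MonoidHom.mrange κ₀)
          (restriction_mem_mrange A Pc E κ κ₀ R q hκ hcns hθ horb hRκ hRθ t)) (K.kummerTheta α x) := by
  obtain ⟨eΨ, heΨ, -⟩ :=
    exists_unique_restrictionIso'_ofKummer A Pc E κ κ₀ R q hκ hcns hθ horb hRκ hRθ hκ₀ t₀ hq₀
  exact exists_kummerRestrictionTransportIso' K α _ eΨ heΨ e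

/-- The same with the Frobenioid-side constant monoid `(Ψ_{†C_v})` READ AS `M_TM` itself and the Kummer copy = the
`G_v`-level Kummer map `κ₀` onto its image (the identification of `Ψ_{†C_v}` with the model `O^▷`/`M_TM` is J5 of
SUBDAG-IUTchII-Prop-31-33-34; Cor 3.6 (i) p.99 l.44–47 «(Ψ_{†C_v})_t ⥲ Ψ_cns(M^Θ_*)_t», paraphrase).
(IUTchII §3 Cor 3.6 (ii), kurims p.100) [claim: Mochizuki2012, status: disputed] -/
theorem exists_kummerRestrictionTransportIso'_ofKummer_self (α : Pc.G) (hκ : Function.Injective κ)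
    (hcns : E.constantMonoid = MonoidHom.mrange κ) {θ : E.H} (hθ : θ ∈ E.thetaEnv (K.label α))
    (horb : ∀ θ' ∈ E.thetaEnv (K.label α), ∃ u ∈ E.units, θ' = u * θ)
    (R : T → (E.thetaMonoid (K.label α) →* M)) (q : T → A.MTM Pc)
    (hRκ : ∀ (t : T) (m : A.MTM Pc) (hm : κ m ∈ E.thetaMonoid (K.label α)), R t ⟨κ m, hm⟩ = κ₀ m)
    (hRθ : ∀ t, R t ⟨θ, thetaEnv_subset_thetaMonoid E (K.label α) hθ⟩ = κ₀ (q t))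
    (hκ₀ : Function.Injective κ₀) (t₀ : T)
    (hq₀ : ∀ (m m' : (A.MTM Pc)ˣ) (n n' : ℕ), (m : A.MTM Pc) * q t₀ ^ n = m' * q t₀ ^ n' → n = n' ∧ m = m') :
    ∃ (e : A.MTM Pc ≃* MonoidHom.mrange κ₀) (Φ : F.frobThetaMonoid α ≃*
        frobenioidGaussianMonoid e (fun t => (R t).codRestrict (MonoidHom.mrange κ₀)
          (restriction_mem_mrange A Pc E κ κ₀ R q hκ hcns hθ horb hRκ hRθ t)
            ⟨θ, thetaEnv_subset_thetaMonoid E (K.label α) hθ⟩)),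
      (∀ m : A.MTM Pc, ((e m : MonoidHom.mrange κ₀) : M) = κ₀ m) ∧
      ∀ x, piIso T e ((Φ x : frobenioidGaussianMonoid e _) : T → A.MTM Pc) =
        MonoidHom.pi (fun t => (R t).codRestrict (MonoidHom.mrange κ₀)
          (restriction_mem_mrange A Pc E κ κ₀ R q hκ hcns hθ horb hRκ hRθ t)) (K.kummerTheta α x) := by
  let e : A.MTM Pc ≃* MonoidHom.mrange κ₀ := MulEquiv.ofBijective κ₀.mrangeRestrict
    ⟨fun _ _ h => hκ₀ (congrArg Subtype.val h), κ₀.mrangeRestrict_surjective⟩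
  obtain ⟨Φ, hΦ⟩ := exists_kummerRestrictionTransportIso'_ofKummer A Pc K κ κ₀ α hκ hcns hθ horb R q hRκ hRθ hκ₀ t₀ hq₀ e
  exact ⟨e, Φ, fun _ => rfl, hΦ⟩

end ThirdDisplayAtKummer

end BadPrimeGaussianMonoids

end Literature.IUT.HodgeArakelov
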